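import Summits.ABC.IUTFork.LDHGenuinePerImageBrobergDiscr
import Summits.ABC.IUTFork.LDHGenuinePerImageSufficiencyNum
import HarnessLib

/-!
# THE RECORDS' SZPIRO-BAD GUARD, IN KERNEL, at the quadratic Broberg point `λ = (8−3√7)²(5−2√7)/(4−3√7)⁴ ∈ ℚ(√7)`:
# Szpiro-bad AS TYPED at EXACTLY the prime levels `l ∈ {7, 11}` (abc-iut cell, R-W lane rows 9/10 companion; seat abc-iut-W-row-2 gen 6)

PROOF-ONLY file (D-0012; 0 definitions, 0 `Prop` facts, no instance, no notation) of the abc-iut cell. TAKES NO SIDE on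
[IUTchIII] Cor. 3.12 / [IUTchIV] Thm. 1.10 or on any author. The R-W WINDOW-TABLE's two quadratic rows «pilotDataOfK:broberg-Q7:7 / :11»
(OPEN-10.md rows 9/10) are DECIDED-INHABITED unconditionally (abc-iut-W-row-2 gen 3, p496949 / p497044), ADMISSIBLE (gen 4,
`BrobergAdmissible` p501150) and their datum types are NON-EMPTY by theorem (gen 5, `BrobergCondP6` p506230). The one tabulated
column of those rows that was still DESK-only (FINDINGS-OF-RECORD v3.0.10 §T.4 T3 (b): «Szpiro-badness … NOT claimed by the row theorems») is
the records' SZPIRO-BAD GUARD — the `hbad` antecedent of abc-iut-c312-d1's cut schema `Cor22.forall_cor312Of_of_szpiroBad`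
(`LDHGenuinePerImageSufficiencyNum`): «`(l+5)/4 < d_mod` or
`6l(l+5−4d_mod)/((l+4)(l−3))·(log-diff + (1 − 1/l)·log 𝔣^{∤2l}) + 6l(l+5)/((l+4)(l−3))·log π < log q^{∤2l}`» — outside it the
NUMBER-level Corollary `T.Cor312Of` is the kernel theorem `Cor22.ThetaVolumeDatumAt.cor312Of_of_szpiro`. Here, for `P ↦ Broberg.point`:

* §1 **`dmod_eq_two : Cor22.dmod Broberg.point = 2`** — the field of moduli `ℚ(j(λ))` is ALL of `ℚ(√7)` (`ratCast_ne_jInv_lam`: `j(λ) ∉ ℚ`,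
  by exact `ℤ[√7]` arithmetic on `λ·(10273 − 3792√7) = 1307 − 494√7`). LOAD-BEARING: with `d_mod = 1` the guard's factor `l+5−4d_mod`
  would read `l+1` and the point would be Szpiro-GOOD at every level; the tree's `dmod_le_two` alone cannot give badness.
* §2 **`szpiroBad_of_eq` / `szpiroBad_seven` / `szpiroBad_eleven`** — the guard VERBATIM at `l = 7` and `l = 11`, from abc-iut-C-cert-2's constants
  `logQAvoid_pair_of_ne` (`13·log 3 + 4·log 47`), `logCondAvoid_pair_of_ne` (`log 3 + ½·log 47`), `logDiff_eq` (`½·log 28`) BY NAME, `π < 3.15`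
  (Mathlib `Real.pi_lt_d2`) and ONE integer certificate per level: `28²¹·63¹²⁶ < 3¹⁰⁷·47²⁶·20¹²⁶` (`l = 7`; true margin 0.3130 nats = the
  table's «szpiro_margin −0.313008») · `28¹¹·63⁴⁴ < 3⁴⁵·47¹⁰·20⁴⁴` (`l = 11`; 0.1833 = «−0.183333»); `not_szpiroGood_seven / _eleven`: the
  Szpiro-type HYPOTHESIS of `cor312Of_of_szpiro` FAILS there.
* §3 **`szpiroGood_five`, `szpiroGood_fortySeven`, `szpiroGood_of_thirteen_le`, `szpiroGood`** — at `l = 5` and at every prime `l ≥ 13` that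
  hypothesis HOLDS (the guard times `(l+4)(l−3) > 0` is the quadratic `a·l² + b·l + c` in the four constants `log 28, log 3, log 47, log π`,
  `a ≈ 5.32`, `b ≈ −97.9`, `c ≈ 410.6`, roots `6.47 / 11.91`; certificates `28³ > 3·47`, `28⁶⁹ > 3³³·47⁴²`, `28³⁹⁰·157¹⁴⁰⁴ > 3¹⁴⁹⁰·47³²⁰·50¹⁴⁰⁴`
  with `π > 3.14` / `π > 3`), hence `cor312Of_of_szpiroGood`: at those levels `T.Cor312Of` IS an instance of `cor312Of_of_szpiro`;
* §4 **`szpiroBad_iff`** — for every prime `l ≥ 5`: «(Broberg.point, l) is Szpiro-bad AS TYPED» `↔ l = 7 ∨ l = 11` — why the table carries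
  exactly two Broberg rows; at `l = 7, 11` abc-iut-C-cert-3's `Broberg.cor312Of_seven / _eleven` (p503174) are therefore NOT instances of the
  Szpiro-good sufficiency theorem.

HONEST SCOPE: elementary arithmetic of ONE quadratic point and real-logarithm inequalities; «Szpiro-bad as typed» is OUR records' guard at
`(Broberg.point, l)`; nothing about [IUTchIII] Cor. 3.12 / [IUTchIV] Thm. 1.10 in print; inhabited-as-typed ≠ true-in-print; no side taken on
any author; typed ≠ proved; NO abc claim. [cite: Mochizuki2012, IUTchIV Thm. 1.10 p. 22–23; Cor. 2.2 (ii) proof p. 44–46]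
[cite: MochizukiGenEll2010, Def. 1.5 (iii) p. 8, Ex. 1.3 (i) p. 5] [claim: Mochizuki2012, status: disputed] for every IUT sentence quoted.
-/

noncomputable section

open scoped Classical NumberField

open NumberField IsDedekindDomain IsDedekindDomain.HeightOneSpectrum QuadraticAlgebra Module

namespace Summit.ABC.IUTFork.Broberg

open Sqrt7 Literature.IUT.LogVolume Literature.IUT.LogVolume.Cor22 Literature.NumberTheory.NumberFields
  Literature.NumberTheory.DiophantineGeometry.GenEll

/-! ## §1. The field of moduli of the Broberg curve is `ℚ(√7)`: `d_mod = 2` -/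

/-- `n²(n−d)²d² = 440915682908954041597152 − 166650463732186350500472·√7` in `ℤ[√7]` for `n = 1307 − 494√7`, `d = 10273 − 3792√7`
(the denominator of `j(λ)·d⁶` cleared through `λ = n/d`). [folklore] -/
theorem jInv_den_eq :
    (1307 - 494 * sqrt7 : K) ^ 2 * ((1307 - 494 * sqrt7) - (10273 - 3792 * sqrt7)) ^ 2 * (10273 - 3792 * sqrt7) ^ 2 =
      440915682908954041597152 - 166650463732186350500472 * sqrt7 := by
  linear_combination ((38167336846613385216 : K) * sqrt7 ^ 4 + (-616287286109434587648 : K) * sqrt7 ^ 3 +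
    (4413376339743405652240 : K) * sqrt7 ^ 2 + (-19190637470332203725232 : K) * sqrt7 + (60917597980764404841668 : K)) * sqrt7_mul_sqrt7

/-- `2⁸·(n² − nd + d²)³ = 6279424900121162946892046080 − 2373399523156679241342515712·√7` in `ℤ[√7]` for `n = 1307 − 494√7`,
`d = 10273 − 3792√7` (the numerator of `j(λ)·d⁶`). [folklore] -/
theorem jInv_num_eq :
    (2 : K) ^ 8 * ((1307 - 494 * sqrt7 : K) ^ 2 - (1307 - 494 * sqrt7) * (10273 - 3792 * sqrt7) + (10273 - 3792 * sqrt7) ^ 2) ^ 3 =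
      6279424900121162946892046080 - 2373399523156679241342515712 * sqrt7 := by
  linear_combination ((530610492122477603995648 : K) * sqrt7 ^ 4 + (-8635899238629833999130624 : K) * sqrt7 ^ 3 +
    (62278016355843826861195264 : K) * sqrt7 ^ 2 + (-272262816207295725024405504 : K) * sqrt7 +
    (866863115639889700880859136 : K)) * sqrt7_mul_sqrt7

/-- **`j(λ) ∉ ℚ`** for Broberg's `λ`: no rational number equals `j(λ) = 2⁸(λ²−λ+1)³/(λ²(λ−1)²)` (clearing denominators through
`λ·(10273 − 3792√7) = 1307 − 494√7` gives `r·(D₁ − D₂√7) = N₁ − N₂√7` with `N₁D₂ ≠ N₂D₁`). [cite: MochizukiGenEll2010, Ex. 1.3 (i) p. 5] -/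
theorem ratCast_ne_jInv_lam (r : ℚ) : (r : K) ≠ jInv lam := by
  intro h
  have hden : lam ^ 2 * (lam - 1) ^ 2 ≠ 0 :=
    mul_ne_zero (pow_ne_zero _ lam_ne_zero) (pow_ne_zero _ lam_sub_one_ne_zero)
  unfold jInv at h
  rw [eq_div_iff hden] at h
  have key : (r : K) * ((lam * (10273 - 3792 * sqrt7)) ^ 2 *
      (lam * (10273 - 3792 * sqrt7) - (10273 - 3792 * sqrt7)) ^ 2 * (10273 - 3792 * sqrt7) ^ 2) =
      2 ^ 8 * ((lam * (10273 - 3792 * sqrt7)) ^ 2 - lam * (10273 - 3792 * sqrt7) * (10273 - 3792 * sqrt7) +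
        (10273 - 3792 * sqrt7) ^ 2) ^ 3 := by
    linear_combination (10273 - 3792 * sqrt7 : K) ^ 6 * h
  rw [lam_mul_den, jInv_den_eq, jInv_num_eq] at key
  have hr : (r : K) = ⟨r, 0⟩ := rfl
  rw [hr] at key
  have h1 := congrArg QuadraticAlgebra.re key
  have h2 := congrArg QuadraticAlgebra.im key
  simp [sqrt7] at h1 h2
  linarith

/-- **`j(λ) ∉ ℚ`**, subfield form: `j(λ)` is not in the bottom intermediate field of `ℚ(√7)/ℚ` (cf. `lam_not_mem_bot` for `λ` itself).
[cite: MochizukiGenEll2010, Ex. 1.3 (i) p. 5] -/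
theorem jInv_lam_not_mem_bot : jInv lam ∉ (⊥ : IntermediateField ℚ K) := by
  rw [IntermediateField.mem_bot]
  rintro ⟨r, hr⟩
  exact ratCast_ne_jInv_lam r ((eq_ratCast _ r).symm.trans hr)

/-- **`d_mod = 2` at Broberg's point: the field of moduli `F_mod = ℚ(j(λ))` is all of `F_tpd = ℚ(√7)`** (`1 ≤ d_mod ≤ [F_tpd:ℚ] = 2` and
`d_mod = 1` would make `j(λ)` rational). [cite: Mochizuki2012, IUTchIV Thm. 1.10 p. 22] [claim: Mochizuki2012, status: disputed] -/
theorem dmod_eq_two : dmod point = 2 := by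
  have h1 := dmod_pos point
  have h2 : dmod point ≤ 2 := by simpa [point_degree] using dmod_le_degree point
  have hne : dmod point ≠ 1 := by
    intro h
    rw [dmod_eq_natDegree, minpoly.natDegree_eq_one_iff] at h
    obtain ⟨r, hr⟩ := RingHom.mem_range.mp h
    exact ratCast_ne_jInv_lam r (((eq_ratCast (algebraMap ℚ point.F) r).symm.trans hr))
  omega

/-- `d_mod = 2` read in `ℝ`. [cite: Mochizuki2012, IUTchIV Thm. 1.10 p. 22] [claim: Mochizuki2012, status: disputed] -/
theorem dmod_cast_eq_two : (dmod point : ℝ) = 2 := by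
  rw [dmod_eq_two]; norm_num

/-! ## §2. Szpiro-bad as typed at `l = 7` and `l = 11` -/

/-- **SZPIRO-BAD AS TYPED at `(Broberg.point, l)` for `l = 7` and `l = 11`** — the `hbad` antecedent of `Cor22.forall_cor312Of_of_szpiroBad`
VERBATIM with `P ↦ Broberg.point`: second disjunct, from `d_mod = 2`, `log-diff = ½·log 28`, `log 𝔣^{∤2l} = log 3 + ½·log 47`,
`log q^{∤2l} = 13·log 3 + 4·log 47`, `π < 3.15` and the integer certificates `28²¹·63¹²⁶ < 3¹⁰⁷·47²⁶·20¹²⁶` (`l = 7`) and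
`28¹¹·63⁴⁴ < 3⁴⁵·47¹⁰·20⁴⁴` (`l = 11`). [cite: Mochizuki2012, IUTchIV Thm. 1.10 p. 22–23; Cor. 2.2 (ii) proof p. 46] [claim: Mochizuki2012, status: disputed] -/
theorem szpiroBad_of_eq {l : ℕ} (hl : l = 7 ∨ l = 11) :
    ((l : ℝ) + 5) / 4 < (dmod point : ℝ) ∨
      6 * l * (((l : ℝ) + 5) - 4 * dmod point) / (((l : ℝ) + 4) * ((l : ℝ) - 3))
          * (point.logDiff + (1 - 1 / (l : ℝ)) * logCondAvoid point {2, l})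
        + 6 * l * ((l : ℝ) + 5) / (((l : ℝ) + 4) * ((l : ℝ) - 3)) * Real.log Real.pi < logQAvoid point {2, l} := by
  refine Or.inr ?_
  have hpi : Real.log Real.pi < Real.log (63 / 20) :=
    Real.log_lt_log Real.pi_pos (by have := Real.pi_lt_d2; norm_num at this ⊢; linarith)
  have h6320 : Real.log (63 / 20 : ℝ) = Real.log 63 - Real.log 20 := Real.log_div (by norm_num) (by norm_num)
  have hp3 : 0 < Real.log 3 := Real.log_pos (by norm_num)
  have hp47 : 0 < Real.log 47 := Real.log_pos (by norm_num)
  rcases hl with rfl | rfl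
  · rw [logQAvoid_pair_of_ne (by norm_num) (by norm_num) (by norm_num),
      logCondAvoid_pair_of_ne (by norm_num) (by norm_num) (by norm_num), logDiff_eq, dmod_cast_eq_two]
    have hZ : (28 : ℕ) ^ 21 * 63 ^ 126 < 3 ^ 107 * 47 ^ 26 * 20 ^ 126 := by norm_num
    have hR : (28 : ℝ) ^ 21 * (63 : ℝ) ^ 126 < (3 : ℝ) ^ 107 * (47 : ℝ) ^ 26 * (20 : ℝ) ^ 126 := by exact_mod_cast hZ
    have hlog := Real.log_lt_log (by positivity) hR
    repeat rw [Real.log_mul (by positivity) (by positivity)] at hlog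
    simp only [Real.log_pow] at hlog
    push_cast at hlog ⊢
    rw [h6320] at hpi
    norm_num
    linarith [hlog, hpi, hp3, hp47]
  · rw [logQAvoid_pair_of_ne (by norm_num) (by norm_num) (by norm_num),
      logCondAvoid_pair_of_ne (by norm_num) (by norm_num) (by norm_num), logDiff_eq, dmod_cast_eq_two]
    have hZ : (28 : ℕ) ^ 11 * 63 ^ 44 < 3 ^ 45 * 47 ^ 10 * 20 ^ 44 := by norm_num
    have hR : (28 : ℝ) ^ 11 * (63 : ℝ) ^ 44 < (3 : ℝ) ^ 45 * (47 : ℝ) ^ 10 * (20 : ℝ) ^ 44 := by exact_mod_cast hZ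
    have hlog := Real.log_lt_log (by positivity) hR
    repeat rw [Real.log_mul (by positivity) (by positivity)] at hlog
    simp only [Real.log_pow] at hlog
    push_cast at hlog ⊢
    rw [h6320] at hpi
    norm_num
    linarith [hlog, hpi, hp3, hp47]

/-- **SZPIRO-BAD AS TYPED at `(Broberg.point, 7)`** (R-W table row «pilotDataOfK:broberg-Q7:7», OPEN-10.md row 9; desk column «szpiro_margin
−0.313008 (BAD)» — kernel margin 0.3130 nats before the `π`-rounding). [cite: Mochizuki2012, IUTchIV Thm. 1.10 p. 22–23] [claim: Mochizuki2012, status: disputed] -/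
theorem szpiroBad_seven :
    (((7 : ℕ) : ℝ) + 5) / 4 < (dmod point : ℝ) ∨
      6 * ((7 : ℕ) : ℝ) * ((((7 : ℕ) : ℝ) + 5) - 4 * dmod point) / ((((7 : ℕ) : ℝ) + 4) * (((7 : ℕ) : ℝ) - 3))
          * (point.logDiff + (1 - 1 / ((7 : ℕ) : ℝ)) * logCondAvoid point {2, 7})
        + 6 * ((7 : ℕ) : ℝ) * (((7 : ℕ) : ℝ) + 5) / ((((7 : ℕ) : ℝ) + 4) * (((7 : ℕ) : ℝ) - 3)) * Real.log Real.pi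
        < logQAvoid point {2, 7} :=
  szpiroBad_of_eq (Or.inl rfl)

/-- **SZPIRO-BAD AS TYPED at `(Broberg.point, 11)`** (R-W table row «pilotDataOfK:broberg-Q7:11», OPEN-10.md row 10; desk column «szpiro_margin
−0.183333 (BAD)» — kernel margin 0.1833 nats before the `π`-rounding). [cite: Mochizuki2012, IUTchIV Thm. 1.10 p. 22–23] [claim: Mochizuki2012, status: disputed] -/
theorem szpiroBad_eleven :
    (((11 : ℕ) : ℝ) + 5) / 4 < (dmod point : ℝ) ∨
      6 * ((11 : ℕ) : ℝ) * ((((11 : ℕ) : ℝ) + 5) - 4 * dmod point) / ((((11 : ℕ) : ℝ) + 4) * (((11 : ℕ) : ℝ) - 3))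
          * (point.logDiff + (1 - 1 / ((11 : ℕ) : ℝ)) * logCondAvoid point {2, 11})
        + 6 * ((11 : ℕ) : ℝ) * (((11 : ℕ) : ℝ) + 5) / ((((11 : ℕ) : ℝ) + 4) * (((11 : ℕ) : ℝ) - 3)) * Real.log Real.pi
        < logQAvoid point {2, 11} :=
  szpiroBad_of_eq (Or.inr rfl)

/-- At `l = 7` and `l = 11` the Szpiro-type HYPOTHESIS of the sufficiency theorem `Cor22.ThetaVolumeDatumAt.cor312Of_of_szpiro` FAILS at
Broberg's point (so `T.Cor312Of` there — abc-iut-C-cert-3's `Broberg.cor312Of_seven / _eleven` — is NOT an instance of it).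
[cite: Mochizuki2012, IUTchIV Thm. 1.10 p. 22–23] [claim: Mochizuki2012, status: disputed] -/
theorem not_szpiroGood_of_eq {l : ℕ} (hl : l = 7 ∨ l = 11) :
    ¬ (logQAvoid point {2, l} ≤
      6 * l * (((l : ℝ) + 5) - 4 * dmod point) / (((l : ℝ) + 4) * ((l : ℝ) - 3))
          * (point.logDiff + (1 - 1 / (l : ℝ)) * logCondAvoid point {2, l})
        + 6 * l * ((l : ℝ) + 5) / (((l : ℝ) + 4) * ((l : ℝ) - 3)) * Real.log Real.pi) := by
  rcases szpiroBad_of_eq hl with h | h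
  · rw [dmod_cast_eq_two] at h
    rcases hl with rfl | rfl <;> norm_num at h
  · exact not_le.mpr h

/-! ## §3. Szpiro-good at `l = 5` and at every prime `l ≥ 13` -/

/-- **Szpiro-GOOD at `l = 5`**: the hypothesis of `cor312Of_of_szpiro` holds at `(Broberg.point, 5)` (certificate `47⁸ ≤ 28⁵·3¹⁹`, `π > 3`;
margin ≈ 3.0 nats). [cite: Mochizuki2012, IUTchIV Thm. 1.10 p. 22–23] [claim: Mochizuki2012, status: disputed] -/
theorem szpiroGood_five :
    logQAvoid point {2, 5} ≤
      6 * ((5 : ℕ) : ℝ) * ((((5 : ℕ) : ℝ) + 5) - 4 * dmod point) / ((((5 : ℕ) : ℝ) + 4) * (((5 : ℕ) : ℝ) - 3))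
          * (point.logDiff + (1 - 1 / ((5 : ℕ) : ℝ)) * logCondAvoid point {2, 5})
        + 6 * ((5 : ℕ) : ℝ) * (((5 : ℕ) : ℝ) + 5) / ((((5 : ℕ) : ℝ) + 4) * (((5 : ℕ) : ℝ) - 3)) * Real.log Real.pi := by
  rw [logQAvoid_pair_of_ne (by norm_num) (by norm_num) (by norm_num),
    logCondAvoid_pair_of_ne (by norm_num) (by norm_num) (by norm_num), logDiff_eq, dmod_cast_eq_two]
  have hpi : Real.log 3 < Real.log Real.pi := Real.log_lt_log (by norm_num) Real.pi_gt_three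
  have hp3 : 0 < Real.log 3 := Real.log_pos (by norm_num)
  have hp28 : 0 < Real.log 28 := Real.log_pos (by norm_num)
  have hp47 : 0 < Real.log 47 := Real.log_pos (by norm_num)
  have hZ : (47 : ℕ) ^ 8 ≤ 28 ^ 5 * 3 ^ 19 := by norm_num
  have hR : (47 : ℝ) ^ 8 ≤ (28 : ℝ) ^ 5 * (3 : ℝ) ^ 19 := by exact_mod_cast hZ
  have hlog := Real.log_le_log (by positivity) hR
  repeat rw [Real.log_mul (by positivity) (by positivity)] at hlog
  simp only [Real.log_pow] at hlog
  push_cast at hlog ⊢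
  norm_num
  linarith [hlog, hpi, hp3, hp28, hp47]

/-- **Szpiro-GOOD at `l = 47`** (the level meeting a bad place: `log q^{∤{2,47}} = 13·log 3`, `log 𝔣^{∤{2,47}} = log 3`; `π > 3`, `log 28 > log 3`;
margin ≈ 8.4 nats). [cite: Mochizuki2012, IUTchIV Thm. 1.10 p. 22–23] [claim: Mochizuki2012, status: disputed] -/
theorem szpiroGood_fortySeven :
    logQAvoid point {2, 47} ≤
      6 * ((47 : ℕ) : ℝ) * ((((47 : ℕ) : ℝ) + 5) - 4 * dmod point) / ((((47 : ℕ) : ℝ) + 4) * (((47 : ℕ) : ℝ) - 3))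
          * (point.logDiff + (1 - 1 / ((47 : ℕ) : ℝ)) * logCondAvoid point {2, 47})
        + 6 * ((47 : ℕ) : ℝ) * (((47 : ℕ) : ℝ) + 5) / ((((47 : ℕ) : ℝ) + 4) * (((47 : ℕ) : ℝ) - 3)) * Real.log Real.pi := by
  rw [logQAvoid_pair_fortySeven, logCondAvoid_pair_fortySeven, logDiff_eq, dmod_cast_eq_two]
  have hpi : Real.log 3 < Real.log Real.pi := Real.log_lt_log (by norm_num) Real.pi_gt_three
  have h328 : Real.log 3 < Real.log 28 := Real.log_lt_log (by norm_num) (by norm_num)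
  have hp3 : 0 < Real.log 3 := Real.log_pos (by norm_num)
  push_cast
  norm_num
  nlinarith [hpi, h328, hp3]

/-- **Szpiro-GOOD at every prime level `l ≥ 13`, `l ≠ 47`**: the hypothesis of `cor312Of_of_szpiro` holds at `(Broberg.point, l)`. Multiplying
the guard by `(l+4)(l−3) > 0` leaves the quadratic `f(l) = a·l² + b·l + c` with `a = 3·log 28 − 7·log 3 − log 47 + 6·log π`,
`26a + b = 69·log 28 − 219·log 3 − 42·log 47 + 186·log π`, `f(13) = 390·log 28 − 1490·log 3 − 320·log 47 + 1404·log π`, all three `≥ 0`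
(certificates `3·47 ≤ 28³`, `3³³·47⁴² ≤ 28⁶⁹` with `π > 3`, and `3¹⁴⁹⁰·47³²⁰·50¹⁴⁰⁴ ≤ 28³⁹⁰·157¹⁴⁰⁴` with `π > 3.14`), and
`f(l) = a(l−13)² + (26a+b)(l−13) + f(13)`. [cite: Mochizuki2012, IUTchIV Thm. 1.10 p. 22–23] [claim: Mochizuki2012, status: disputed] -/
theorem szpiroGood_of_thirteen_le {l : ℕ} (hl : l.Prime) (h13 : 13 ≤ l) (h47 : l ≠ 47) :
    logQAvoid point {2, l} ≤
      6 * l * (((l : ℝ) + 5) - 4 * dmod point) / (((l : ℝ) + 4) * ((l : ℝ) - 3))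
          * (point.logDiff + (1 - 1 / (l : ℝ)) * logCondAvoid point {2, l})
        + 6 * l * ((l : ℝ) + 5) / (((l : ℝ) + 4) * ((l : ℝ) - 3)) * Real.log Real.pi := by
  rw [logQAvoid_pair_of_ne hl (by omega) h47, logCondAvoid_pair_of_ne hl (by omega) h47, logDiff_eq, dmod_cast_eq_two]
  have hx : (13 : ℝ) ≤ (l : ℝ) := by exact_mod_cast h13
  -- the three sign certificates
  have hpi3 : Real.log 3 < Real.log Real.pi := Real.log_lt_log (by norm_num) Real.pi_gt_three
  have hpi314 : Real.log (157 / 50) < Real.log Real.pi :=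
    Real.log_lt_log (by norm_num) (by have := Real.pi_gt_d2; norm_num at this ⊢; linarith)
  have h15750 : Real.log (157 / 50 : ℝ) = Real.log 157 - Real.log 50 := Real.log_div (by norm_num) (by norm_num)
  rw [h15750] at hpi314
  have ha : 0 ≤ 3 * Real.log 28 - 7 * Real.log 3 - Real.log 47 + 6 * Real.log Real.pi := by
    have hZ : (3 : ℕ) * 47 ≤ 28 ^ 3 := by norm_num
    have hR : (3 : ℝ) * 47 ≤ (28 : ℝ) ^ 3 := by exact_mod_cast hZ
    have hlog := Real.log_le_log (by positivity) hR
    repeat rw [Real.log_mul (by positivity) (by positivity)] at hlog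
    simp only [Real.log_pow] at hlog
    push_cast at hlog
    linarith
  have hb : 0 ≤ 69 * Real.log 28 - 219 * Real.log 3 - 42 * Real.log 47 + 186 * Real.log Real.pi := by
    have hZ : (3 : ℕ) ^ 33 * 47 ^ 42 ≤ 28 ^ 69 := by norm_num
    have hR : (3 : ℝ) ^ 33 * (47 : ℝ) ^ 42 ≤ (28 : ℝ) ^ 69 := by exact_mod_cast hZ
    have hlog := Real.log_le_log (by positivity) hR
    repeat rw [Real.log_mul (by positivity) (by positivity)] at hlog
    simp only [Real.log_pow] at hlog
    push_cast at hlog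
    linarith
  have hc : 0 ≤ 390 * Real.log 28 - 1490 * Real.log 3 - 320 * Real.log 47 + 1404 * Real.log Real.pi := by
    -- `3¹⁴⁹⁰·47³²⁰·50¹⁴⁰⁴ ≤ 28³⁹⁰·157¹⁴⁰⁴`, written with exponents `≤ 256` (`3¹⁰ = 59049`, `47² = 2209`, `50⁶`, `28² = 784`, `157⁶`)
    have hZ : (59049 : ℕ) ^ 149 * 2209 ^ 160 * 15625000000 ^ 234 ≤ 784 ^ 195 * 14976071831449 ^ 234 := by norm_num
    have hR : (59049 : ℝ) ^ 149 * (2209 : ℝ) ^ 160 * (15625000000 : ℝ) ^ 234 ≤ (784 : ℝ) ^ 195 * (14976071831449 : ℝ) ^ 234 := by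
      exact_mod_cast hZ
    have hlog := Real.log_le_log (by positivity) hR
    repeat rw [Real.log_mul (by positivity) (by positivity)] at hlog
    simp only [Real.log_pow] at hlog
    push_cast at hlog
    have e3 : Real.log 59049 = 10 * Real.log 3 := by
      rw [show (59049 : ℝ) = 3 ^ 10 by norm_num, Real.log_pow]; push_cast; ring
    have e47 : Real.log 2209 = 2 * Real.log 47 := by
      rw [show (2209 : ℝ) = 47 ^ 2 by norm_num, Real.log_pow]; push_cast; ring
    have e50 : Real.log 15625000000 = 6 * Real.log 50 := by
      rw [show (15625000000 : ℝ) = 50 ^ 6 by norm_num, Real.log_pow]; push_cast; ring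
    have e28 : Real.log 784 = 2 * Real.log 28 := by
      rw [show (784 : ℝ) = 28 ^ 2 by norm_num, Real.log_pow]; push_cast; ring
    have e157 : Real.log 14976071831449 = 6 * Real.log 157 := by
      rw [show (14976071831449 : ℝ) = 157 ^ 6 by norm_num, Real.log_pow]; push_cast; ring
    rw [e3, e47, e50, e28, e157] at hlog
    linarith
  -- the quadratic, multiplied out
  have key : (13 * Real.log 3 + 4 * Real.log 47) * (((l : ℝ) + 4) * ((l : ℝ) - 3)) ≤
      6 * ((l : ℝ) - 3) * ((l : ℝ) * (Real.log 28 / 2) + ((l : ℝ) - 1) * (Real.log 3 + Real.log 47 / 2))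
        + 6 * (l : ℝ) * ((l : ℝ) + 5) * Real.log Real.pi := by
    have expand : 6 * ((l : ℝ) - 3) * ((l : ℝ) * (Real.log 28 / 2) + ((l : ℝ) - 1) * (Real.log 3 + Real.log 47 / 2))
        + 6 * (l : ℝ) * ((l : ℝ) + 5) * Real.log Real.pi - (13 * Real.log 3 + 4 * Real.log 47) * (((l : ℝ) + 4) * ((l : ℝ) - 3)) =
        (3 * Real.log 28 - 7 * Real.log 3 - Real.log 47 + 6 * Real.log Real.pi) * ((l : ℝ) - 13) ^ 2
          + (69 * Real.log 28 - 219 * Real.log 3 - 42 * Real.log 47 + 186 * Real.log Real.pi) * ((l : ℝ) - 13)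
          + (390 * Real.log 28 - 1490 * Real.log 3 - 320 * Real.log 47 + 1404 * Real.log Real.pi) := by
      ring
    nlinarith [mul_nonneg ha (sq_nonneg ((l : ℝ) - 13)), mul_nonneg hb (sub_nonneg.2 hx), hc, expand]
  -- back to the displayed (divided) form
  have hx0 : (l : ℝ) ≠ 0 := by linarith
  have hden : 0 < ((l : ℝ) + 4) * ((l : ℝ) - 3) := mul_pos (by linarith) (by linarith)
  have hsub : 6 * (l : ℝ) * (((l : ℝ) + 5) - 4 * 2) * (Real.log 28 / 2 + (1 - 1 / (l : ℝ)) * (Real.log 3 + Real.log 47 / 2)) =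
      6 * ((l : ℝ) - 3) * ((l : ℝ) * (Real.log 28 / 2) + ((l : ℝ) - 1) * (Real.log 3 + Real.log 47 / 2)) := by
    field_simp
    ring
  rw [div_mul_eq_mul_div, div_mul_eq_mul_div, ← add_div, le_div_iff₀ hden, hsub]
  linarith [key]

/-- **Szpiro-GOOD at every prime `l ≥ 5` other than `7` and `11`** (the three cases `l = 5`, `l = 47`, `l ≥ 13`; no prime in `{6, 8, 9, 10, 12}`).
[cite: Mochizuki2012, IUTchIV Thm. 1.10 p. 22–23] [claim: Mochizuki2012, status: disputed] -/
theorem szpiroGood {l : ℕ} (hl : l.Prime) (h5 : 5 ≤ l) (h7 : l ≠ 7) (h11 : l ≠ 11) :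
    logQAvoid point {2, l} ≤
      6 * l * (((l : ℝ) + 5) - 4 * dmod point) / (((l : ℝ) + 4) * ((l : ℝ) - 3))
          * (point.logDiff + (1 - 1 / (l : ℝ)) * logCondAvoid point {2, l})
        + 6 * l * ((l : ℝ) + 5) / (((l : ℝ) + 4) * ((l : ℝ) - 3)) * Real.log Real.pi := by
  by_cases h13 : 13 ≤ l
  · by_cases h47 : l = 47
    · subst h47; exact szpiroGood_fortySeven
    · exact szpiroGood_of_thirteen_le hl h13 h47
  · interval_cases l
    · exact szpiroGood_five
    · exact absurd hl (by norm_num)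
    · exact absurd rfl h7
    · exact absurd hl (by norm_num)
    · exact absurd hl (by norm_num)
    · exact absurd hl (by norm_num)
    · exact absurd rfl h11
    · exact absurd hl (by norm_num)

/-- **At every Szpiro-good prime level the NUMBER-level Corollary at Broberg's point IS an instance of `cor312Of_of_szpiro`**: for every prime
`l ≥ 5`, `l ∉ {7, 11}`, and every genuine Θ-volume datum `T` of `(λ_Broberg, l)`, `T.Cor312Of` (reading (U); abc-iut-C-cert-2's
`cor312PerImageOf_every` gives the stronger reading (P) at every `l ≥ 5` by other means). [cite: Mochizuki2012, IUTchIII Cor. 3.12 p. 173–174]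
[claim: Mochizuki2012, status: disputed] -/
theorem cor312Of_of_szpiroGood {l : ℕ} (hl : l.Prime) (h5 : 5 ≤ l) (h7 : l ≠ 7) (h11 : l ≠ 11)
    (T : ThetaVolumeDatumAt point l) : T.Cor312Of :=
  T.cor312Of_of_szpiro point_inU h5
    (by rw [dmod_cast_eq_two]; have : (5 : ℝ) ≤ l := (by exact_mod_cast h5); linarith)
    (szpiroGood hl h5 h7 h11)

/-! ## §4. The classification: Szpiro-bad as typed at exactly `l ∈ {7, 11}` -/

/-- **THE BROBERG POINT IS SZPIRO-BAD AS TYPED AT EXACTLY THE PRIME LEVELS `l ∈ {7, 11}`**: for every prime `l ≥ 5`, the records' guard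
(`hbad` of `Cor22.forall_cor312Of_of_szpiroBad`, `P ↦ Broberg.point`) holds iff `l = 7 ∨ l = 11` — the R-W window table's two quadratic rows
«pilotDataOfK:broberg-Q7:7 / :11» and no others. [cite: Mochizuki2012, IUTchIV Thm. 1.10 p. 22–23; Cor. 2.2 (ii) proof p. 46] [claim: Mochizuki2012, status: disputed] -/
theorem szpiroBad_iff {l : ℕ} (hl : l.Prime) (h5 : 5 ≤ l) :
    (((l : ℝ) + 5) / 4 < (dmod point : ℝ) ∨
      6 * l * (((l : ℝ) + 5) - 4 * dmod point) / (((l : ℝ) + 4) * ((l : ℝ) - 3))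
          * (point.logDiff + (1 - 1 / (l : ℝ)) * logCondAvoid point {2, l})
        + 6 * l * ((l : ℝ) + 5) / (((l : ℝ) + 4) * ((l : ℝ) - 3)) * Real.log Real.pi < logQAvoid point {2, l}) ↔
    (l = 7 ∨ l = 11) := by
  constructor
  · intro h
    by_cases h7 : l = 7
    · exact Or.inl h7
    by_cases h11 : l = 11
    · exact Or.inr h11
    exfalso
    rcases h with hd | hq
    · rw [dmod_cast_eq_two] at hd
      have : (5 : ℝ) ≤ l := by exact_mod_cast h5
      linarith
    · exact absurd (szpiroGood hl h5 h7 h11) (not_le.mpr hq)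
  · exact szpiroBad_of_eq

end Summit.ABC.IUTFork.Broberg

end
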